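import Summits.Ventures.HSemireg.WedgeHankelRecurrenceGaussChebyshevLucasVGcd

/-!
# Venture HSemireg — **GCDs OF INTEGER VALUES OF CHEBYSHEV POLYNOMIALS: for every integer `a`, `gcd(T_m(a), T_n(a)) = |T_{gcd(m,n)}(a)|` if `m ∕ gcd`, `n ∕ gcd` are both odd and `= 1` otherwise;
# `gcd(T_m(a), U_{n−1}(a)) = |T_{gcd(m,n)}(a)|` if `n ∕ gcd(m,n)` is even and `= 1` otherwise** (the halved companion Lucas numbers `T_n(a) = V_n(2a,1)∕2` and `U_{n−1}(a) = U_n(2a, 1)`; e.g.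
# `a = 2`: `T_n(2) = 1, 2, 7, 26, 97, …`, `U_{n−1}(2) = 0, 1, 4, 15, 56, …`) — the ideal identities N458 ∕ N462 of `ℤ[X]` evaluated at `X = a` (an ideal `= ℤ[X]` evaluates to coprime values,
# with no parity-of-`2` exception, in contrast with the Dickson normalisation N476)

HONEST FRAMING. Part of the Lean index of the computation cell `pub-hsemireg` (seat p10 gen 48, Sunday typer «UNIFORM-IN-n»).  Integer ∕ ideal arithmetic only; no variety, no cohomology theory,
no sheaf, no Ext group and no semiregularity map is constructed here; nothing here says that HC / HC_CM / HC_AV holds; no Literature fact (unproved `Prop`) is declared or used.  Custodian versions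
as in `WedgeHankelSiegelIdeal` (1/3).
SOURCES (cited).  W. L. McDaniel, Fibonacci Quart. 29 (1991) 24–29 (gcd laws for Lucas sequences); P. Ribenboim, *My Numbers, My Friends* (2000), Ch. 1 §IV; T. J. Rivlin, *Chebyshev Polynomials* (1990),
§5.2 (arithmetic of the integers `T_n(a)`).
PROOF TYPED HERE.  N458 `chebyshevT_span_pair_eq_span_gcd ∕ _eq_top`; N462 `chebyshevTU_span_pair_eq_span_gcd ∕ _eq_top`; N476 `int_gcd_eq_natAbs_of_span_pair_eq`, `int_gcd_eq_of_span_pair_eq`; Mathlib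
`Polynomial.evalRingHom`, `Ideal.map_span`, `Ideal.map_top`, `Set.image_pair ∕ image_singleton`, `Ideal.span_singleton_one`.
DEDUP DISCLOSURE (`rg -n 'int_gcd_eq_one_of_span_pair_eq_top|chebyshevT_int_eval_gcd|chebyshevTU_int_eval_gcd' Summits Literature HarnessLib`, 2026-09-04): 0 hits for the 3 names below.

WHAT IS IN THE TREE.  N458, N462, N476.
THIS FILE (namespace `Summit.Ventures.HSemireg.Wedge.HankelOuter` continued; CHAINED on N476; 0 definitions):
* §1242 `int_gcd_eq_one_of_span_pair_eq_top`, **`chebyshevT_int_eval_gcd`**, **`chebyshevTU_int_eval_gcd`**.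
CAVEATS.  `ℕ`-division conventions as in N458 (`U_{−1} = 0`).  Nothing Ext-side.  New names only.
-/

open Module Polynomial
open scoped Matrix Polynomial

namespace Summit.Ventures.HSemireg.Wedge.HankelOuter

/-! ## §1242. `gcd(T_m(a), T_n(a))` and `gcd(T_m(a), U_{n−1}(a))` for integers `a` -/

/-- In `ℤ`: if `(x, y) = ℤ` then `gcd(x, y) = 1`. [this file, §1242] -/
theorem int_gcd_eq_one_of_span_pair_eq_top {x y : ℤ} (h : Ideal.span ({x, y} : Set ℤ) = ⊤) : Int.gcd x y = 1 := by
  rw [← Ideal.span_singleton_one] at h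
  have h1 := int_gcd_eq_natAbs_of_span_pair_eq h
  rwa [Int.natAbs_one] at h1

/-- **`gcd(T_m(a), T_n(a)) = |T_{gcd(m,n)}(a)|` if `m ∕ gcd`, `n ∕ gcd` are both odd, `= 1` otherwise** (every integer `a`). [McDaniel 1991 (halved companion form); this file, §1242] -/
theorem chebyshevT_int_eval_gcd (a : ℤ) (m n : ℕ) :
    Int.gcd ((Polynomial.Chebyshev.T ℤ (m : ℤ)).eval a) ((Polynomial.Chebyshev.T ℤ (n : ℤ)).eval a) =
      if Odd (m / Nat.gcd m n) ∧ Odd (n / Nat.gcd m n) then ((Polynomial.Chebyshev.T ℤ (Nat.gcd m n : ℤ)).eval a).natAbs else 1 := by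
  have hev : ∀ k : ℤ, Polynomial.evalRingHom a (Polynomial.Chebyshev.T ℤ k) = (Polynomial.Chebyshev.T ℤ k).eval a := fun k => rfl
  by_cases hP : Odd (m / Nat.gcd m n) ∧ Odd (n / Nat.gcd m n)
  · rw [if_pos hP]
    have h := congrArg (Ideal.map (Polynomial.evalRingHom a)) (chebyshevT_span_pair_eq_span_gcd (R := ℤ) hP)
    rw [Ideal.map_span, Ideal.map_span, Set.image_pair, Set.image_singleton, hev, hev, hev] at h
    exact int_gcd_eq_natAbs_of_span_pair_eq h
  · rw [if_neg hP]
    have h := congrArg (Ideal.map (Polynomial.evalRingHom a)) (chebyshevT_span_pair_eq_top (R := ℤ) hP)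
    rw [Ideal.map_span, Set.image_pair, hev, hev, Ideal.map_top] at h
    exact int_gcd_eq_one_of_span_pair_eq_top h

/-- **`gcd(T_m(a), U_{n−1}(a)) = |T_{gcd(m,n)}(a)|` if `n ∕ gcd(m,n)` is even, `= 1` otherwise** (every integer `a`). [this file, §1242] -/
theorem chebyshevTU_int_eval_gcd (a : ℤ) (m n : ℕ) :
    Int.gcd ((Polynomial.Chebyshev.T ℤ (m : ℤ)).eval a) ((Polynomial.Chebyshev.U ℤ ((n : ℤ) - 1)).eval a) =
      if Even (n / Nat.gcd m n) then ((Polynomial.Chebyshev.T ℤ (Nat.gcd m n : ℤ)).eval a).natAbs else 1 := by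
  have hevT : ∀ k : ℤ, Polynomial.evalRingHom a (Polynomial.Chebyshev.T ℤ k) = (Polynomial.Chebyshev.T ℤ k).eval a := fun k => rfl
  have hevU : ∀ k : ℤ, Polynomial.evalRingHom a (Polynomial.Chebyshev.U ℤ k) = (Polynomial.Chebyshev.U ℤ k).eval a := fun k => rfl
  by_cases hP : Even (n / Nat.gcd m n)
  · rw [if_pos hP]
    have h := congrArg (Ideal.map (Polynomial.evalRingHom a)) (chebyshevTU_span_pair_eq_span_gcd (R := ℤ) hP)
    rw [Ideal.map_span, Ideal.map_span, Set.image_pair, Set.image_singleton, hevT, hevU, hevT] at h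
    exact int_gcd_eq_natAbs_of_span_pair_eq h
  · rw [if_neg hP]
    have h := congrArg (Ideal.map (Polynomial.evalRingHom a)) (chebyshevTU_span_pair_eq_top (R := ℤ) hP)
    rw [Ideal.map_span, Set.image_pair, hevT, hevU, Ideal.map_top] at h
    exact int_gcd_eq_one_of_span_pair_eq_top h

end Summit.Ventures.HSemireg.Wedge.HankelOuter
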